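import Summits.QuantumFields.BalabanUV.Beta.D1BFx.TorusWeightMixedArrays
import Summits.QuantumFields.BalabanUV.Beta.D1BFx.TorusArrayLimitUniform

/-!
# TB4-W PART 3b-N (FILE N3f) — (u2): the entrywise infinite-volume limits of the mixed weight table `BwMix` (road «BF-x», slot (K); ρ-g7-8)

Ruling ρ-g7-8 (u2): along the road's family of tori `σ k = (m+1)·p k → ∞` every entry of the k-indexed `ℤ⁴` table
`BwMix (σ k) (m+1) a κ u l u′` converges, to the entry of the EXPLICIT limit table `BwMixInf (m+1) a κ u l u′` obtained by the three
substitutions `arr s Y ↦ Y` (TA2 `tendsto_arr`, `tendsto_comp_arr_apply`), `eYe s κ u l u′ Y ↦ eYeInf κ u l u′ Y` (one entry of `Y`, N3a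
`tendsto_eYe`) and torus test `(σu, κ) = (σu′, l)` ↦ `ℤ⁴` test `u = u′ ∧ κ = l` (eventually equal, B2 `torus_test_iff`).  Fixed legs on the
right of a k-family are handled through `trK` and the socket lemma `TorusArrayLimitUniform.tendsto_comp_apply_of_uniform`.
[our object] limit kernels are definitions asserting nothing; [folklore] dominated convergence.
-/

noncomputable section

namespace Summit.QuantumFields.BalabanUV.Beta.D1BFx.TorusWeightMixedLimit

open Filter Topology
open scoped BigOperators
open Literature.MathematicalPhysics.QuantumFieldTheory.Balaban1983to89
open Literature.MathematicalPhysics.QuantumFieldTheory.Balaban1983to89.Beta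
open B12Sec2to5 (l1 l1_nonneg)
open AffineAveraging (unitVec)
open ExpKernelCalculus (MKer BiLoc Decays Zl comp biLoc_comp_decays)
open BalabanStepJetsSucc (biLoc_comp_right)
open Summit.QuantumFields.BalabanUV.Beta.TameKernelCalculus (decays_of_le trK biLoc_trK decays_trK trK_comp)
open Summit.QuantumFields.BalabanUV.Beta.D1BFx.PeriodicArrays (arr toF decays_arr tendsto_arr)
open Summit.QuantumFields.BalabanUV.Beta.D1BFx.FibredPeriodisation (Kfib)
open Summit.QuantumFields.BalabanUV.Beta.D1BFx.GhostStencil (ghCur biLoc_ghCur l1_zero)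
open Summit.QuantumFields.BalabanUV.Beta.D1BFx.RJetProjector (Rgt)
open Summit.QuantumFields.BalabanUV.Beta.D1BFx.RJetAssembly (dSw dSw_apply)
open Summit.QuantumFields.BalabanUV.Beta.D1BFx.TorusJetSandwichArrays (jetR jetC)
open Summit.QuantumFields.BalabanUV.Beta.D1BFx.TorusGhostWordArrays (lapU Lgh biLoc_Lgh cL)
open Summit.QuantumFields.BalabanUV.Beta.D1BFx.TorusGhostPairStencils (gh₂ biLoc_gh₂ torus_test_iff)
open Summit.QuantumFields.BalabanUV.Beta.D1BFx.KGhostLeg (Cgh isPeriodic₂_Rgt)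
open Summit.QuantumFields.BalabanUV.Beta.D1BFx.TorusBondArrays (dB dB_pos dB_le_one decays_lapU_Cgh decays_Cgh_lapU)
open Summit.QuantumFields.BalabanUV.Beta.D1BFx.TorusWeightWordArrays (wL wR wC decays_Rgt_dB)
open Summit.QuantumFields.BalabanUV.Beta.D1BFx.TorusArrayLimitUniform (tendsto_comp_apply_of_uniform)
open Summit.QuantumFields.BalabanUV.Beta.D1BFx.TorusTwoArrayWords (biLoc_comp_arr eYe tendsto_eYe tendsto_comp_arr_apply)
open Summit.QuantumFields.BalabanUV.Beta.D1BFx.TorusMixedLetters (decays_Cgh_dB decays_A₃ decays_A₄)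
open Summit.QuantumFields.BalabanUV.Beta.D1BFx.TorusWeightMixedTerms (K5 K7 K9 Z4 K4 biLoc_wR biLoc_wL biLoc_wC)
open Summit.QuantumFields.BalabanUV.Beta.D1BFx.TorusWeightMixedArrays (BwMix)

/-! ## §1 The limit kernels -/

section Kernels

variable (n : ℕ) [NeZero n] (a : ℝ) (κ : Fin 4) (u : Fin 4 → ℤ) (l : Fin 4) (u' : Fin 4 → ℤ)

/-- [our object] The limit of the two-`Ê` table `eYe s κ u l u′ Y`: one entry of `Y` on the cell `(u,u′)`, direction `(κ,l)`. A definition. -/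
def eYeInf (Y : MKer 4 Unit) : MKer 4 (Fin 4) := fun x z α β =>
  if x = u ∧ z = u' then (if α = κ ∧ β = l then Y (u + unitVec κ) (u' + unitVec l) () () else 0) else 0

/-- [our object] The limit of `K5`. A definition. -/
def K5Inf : MKer 4 (Fin 4) :=
  -dSw (comp (comp (ghCur κ u) (Cgh n a)) (ghCur l u')) + jetC l u' (wL n a κ u) - jetR κ u (wR n a l u') + eYeInf κ u l u' (Rgt n a)

/-- [our object] The limit of `K7`. A definition. -/
def K7Inf : MKer 4 (Fin 4) :=
  -dSw (comp (comp (comp (comp lapU (Cgh n a)) (Lgh κ u)) (Cgh n a)) (ghCur l u')) + jetC l u' (wC n a κ u)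

/-- [our object] The limit of `K9` (the torus test has become the `ℤ⁴` test). A definition. -/
def K9Inf : MKer 4 (Fin 4) :=
  (if u = u' ∧ κ = l then dSw (comp (comp lapU (Cgh n a)) (gh₂ κ u)) else 0)
    - jetC l u' (wR n a κ u) - jetC κ u (wR n a l u') + (if u = u' ∧ κ = l then jetC κ u (Rgt n a) else 0)

/-- [our object] The limit of the site kernel `Z4`. A definition. -/
def Z4Inf : MKer 4 Unit :=
  -((if u = u' ∧ κ = l then
        comp (comp (comp lapU (Cgh n a)) (gh₂ κ u)) (comp lapU (comp (Cgh n a) lapU))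
          + comp (comp (comp (comp lapU (Cgh n a)) lapU) (gh₂ κ u)) (comp (Cgh n a) lapU) else 0)
      + comp (comp (wR n a κ u) (ghCur l u')) (comp (Cgh n a) lapU)
      + comp (comp (wR n a l u') (ghCur κ u)) (comp (Cgh n a) lapU))
    + comp (comp (comp (comp (comp lapU (Cgh n a)) (Lgh κ u)) (Cgh n a)) (Lgh l u')) (comp (Cgh n a) lapU)
    + comp (comp (comp (comp (comp lapU (Cgh n a)) (Lgh l u')) (Cgh n a)) (Lgh κ u)) (comp (Cgh n a) lapU)

/-- [our object] The limit of `K4 = dSw Z4`. A definition. -/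
def K4Inf : MKer 4 (Fin 4) := dSw (Z4Inf n a κ u l u')

/-- [our object] **THE LIMIT TABLE OF `2•wgtMix`**. A definition. -/
def BwMixInf : MKer 4 (Fin 4) :=
  (2 : ℝ) • (trK (K9Inf n a κ u l u') - trK (K7Inf n a l u' κ u) - trK (K7Inf n a κ u l u') + K4Inf n a κ u l u' + K5Inf n a κ u l u'
    + trK (K5Inf n a κ u l u') + K7Inf n a κ u l u' + K7Inf n a l u' κ u + K9Inf n a κ u l u')

end Kernels

/-! ## §2 Entrywise limit letters -/

section Letters

variable {F : ℕ → MKer 4 Unit} {G : MKer 4 Unit}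

/-- [folklore] `dSw` of an entrywise convergent family converges entrywise. -/
theorem tendsto_dSw_apply (h : ∀ x y a b, Tendsto (fun k => F k x y a b) atTop (𝓝 (G x y a b))) (x z : Fin 4 → ℤ) (α β : Fin 4) :
    Tendsto (fun k => dSw (F k) x z α β) atTop (𝓝 (dSw G x z α β)) := by
  simp only [dSw_apply]
  exact (((h _ _ _ _).sub (h _ _ _ _)).sub (h _ _ _ _)).add (h _ _ _ _)

/-- [folklore] `jetC` of an entrywise convergent family converges entrywise. -/
theorem tendsto_jetC_apply (κ : Fin 4) (u : Fin 4 → ℤ) (h : ∀ x y a b, Tendsto (fun k => F k x y a b) atTop (𝓝 (G x y a b)))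
    (x z : Fin 4 → ℤ) (α β : Fin 4) : Tendsto (fun k => jetC κ u (F k) x z α β) atTop (𝓝 (jetC κ u G x z α β)) := by
  unfold jetC
  split_ifs
  · exact (h _ _ _ _).sub (h _ _ _ _)
  · exact tendsto_const_nhds

/-- [folklore] `jetR` of an entrywise convergent family converges entrywise. -/
theorem tendsto_jetR_apply (κ : Fin 4) (u : Fin 4 → ℤ) (h : ∀ x y a b, Tendsto (fun k => F k x y a b) atTop (𝓝 (G x y a b)))
    (x z : Fin 4 → ℤ) (α β : Fin 4) : Tendsto (fun k => jetR κ u (F k) x z α β) atTop (𝓝 (jetR κ u G x z α β)) := by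
  unfold jetR
  split_ifs
  · exact (h _ _ _ _).sub (h _ _ _ _)
  · exact tendsto_const_nhds

/-- [folklore] **THE TORUS TEST BECOMES THE `ℤ⁴` TEST**: along `σ k → ∞`, `[(σ_k u, κ) = (σ_k u′, l)]·f k → [u = u′ ∧ κ = l]·lim f`. -/
theorem tendsto_ite_torus {σ : ℕ → ℕ} [∀ k, NeZero (σ k)] (hσ : Tendsto σ atTop atTop) {u u' : Fin 4 → ℤ} (κ l : Fin 4)
    {f : ℕ → ℝ} {c : ℝ} (hf : Tendsto f atTop (𝓝 c)) :
    Tendsto (fun k => if (siteOf 4 (σ k) u, κ) = (siteOf 4 (σ k) u', l) then f k else 0) atTop (𝓝 (if u = u' ∧ κ = l then c else 0)) := by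
  have hev : ∀ᶠ k in atTop, (if u = u' ∧ κ = l then f k else 0)
      = (if (siteOf 4 (σ k) u, κ) = (siteOf 4 (σ k) u', l) then f k else 0) := by
    filter_upwards [hσ.eventually_gt_atTop ⌈l1 (u - u')⌉₊] with k hk
    have hs : l1 (u - u') < (σ k : ℝ) := (Nat.le_ceil _).trans_lt (by exact_mod_cast hk)
    simp only [torus_test_iff (σ k) κ l hs]
  refine Tendsto.congr' hev ?_
  split_ifs
  · exact hf
  · exact tendsto_const_nhds

/-- [folklore] **FIXED LEG ON THE RIGHT** (mirror of the socket lemma through `trK`): `comp (K k) A → comp Kinf A` entrywise for a uniformly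
bi-localised entrywise convergent family `K k` and a decaying leg `A`. -/
theorem tendsto_comp_right_of_uniform {Fb : Type*} [Fintype Fb] [DecidableEq Fb] {A : MKer 4 Fb} {CA δA : ℝ} (hA : Decays A CA δA)
    (hδA : 0 < δA) {K : ℕ → MKer 4 Fb} {Kinf : MKer 4 Fb} {p q : Fin 4 → ℤ} {C δ : ℝ} (hK : ∀ k, BiLoc (K k) p q C δ) (hδ : 0 < δ)
    (hlim : ∀ x y a b, Tendsto (fun k => K k x y a b) atTop (𝓝 (Kinf x y a b))) (x z : Fin 4 → ℤ) (a b : Fb) :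
    Tendsto (fun k => comp (K k) A x z a b) atTop (𝓝 (comp Kinf A x z a b)) := by
  have h := tendsto_comp_apply_of_uniform (decays_trK hA) hδA (fun k => biLoc_trK (hK k)) hδ
    (Kinf := trK Kinf) (fun x y a b => hlim y x b a) z x b a
  have e : ∀ (L : MKer 4 Fb), comp (trK A) (trK L) z x b a = comp L A x z a b := fun L => by
    rw [← trK_comp]; rfl
  simpa only [e] using h

end Letters

/-! ## §3 The limits of the pieces -/

section Pieces

/-- [folklore] `(m+1)·p k → ∞` when `p k → ∞`. -/
theorem tendsto_sigma (m : ℕ) (p : ℕ → ℕ) (hp : Tendsto p atTop atTop) : Tendsto (fun k => (m + 1) * p k) atTop atTop :=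
  tendsto_atTop_mono (fun k => Nat.le_mul_of_pos_left (p k) (Nat.succ_pos m)) hp

variable (m : ℕ) {a : ℝ} (p : ℕ → ℕ) [∀ k, NeZero (p k)] (κ : Fin 4) (u : Fin 4 → ℤ) (l : Fin 4) (u' : Fin 4 → ℤ)

/-- [folklore] **(u2) FOR `K5`**. -/
theorem tendsto_K5 (ha : 0 < a) (hp : Tendsto p atTop atTop) (x z : Fin 4 → ℤ) (α β : Fin 4) :
    Tendsto (fun k => K5 ((m + 1) * p k) (m + 1) a κ u l u' x z α β) atTop (𝓝 (K5Inf (m + 1) a κ u l u' x z α β)) := by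
  have hσ := tendsto_sigma m p hp
  have hd := dB_pos (m + 1) a ha
  obtain ⟨C, hC⟩ := decays_Cgh_dB m ha
  obtain ⟨CL, -, hL⟩ := biLoc_wL m ha
  obtain ⟨CR, -, hR⟩ := biLoc_wR m ha
  have hX : BiLoc (comp (ghCur κ u) (Cgh (m + 1) a)) u u _ (dB (m + 1) a / 4) :=
    biLoc_comp_right (biLoc_ghCur κ u (dB (m + 1) a / 2)) hC (by linarith) (by linarith)
  have T1 : ∀ x y v w, Tendsto (fun k => comp (comp (ghCur κ u) (Cgh (m + 1) a)) (arr ((m + 1) * p k) (ghCur l u')) x y v w) atTop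
      (𝓝 (comp (comp (ghCur κ u) (Cgh (m + 1) a)) (ghCur l u') x y v w)) :=
    fun x y v w => tendsto_comp_arr_apply (σ := fun k => (m + 1) * p k) hX (biLoc_ghCur l u' (dB (m + 1) a / 4)) (by linarith) hσ x y v w
  have T2 : ∀ x y v w, Tendsto (fun k => arr ((m + 1) * p k) (wL (m + 1) a κ u) x y v w) atTop (𝓝 (wL (m + 1) a κ u x y v w)) :=
    fun x y v w => (tendsto_arr (hL κ u) (by linarith) x y v w).comp hσ
  have T3 : ∀ x y v w, Tendsto (fun k => arr ((m + 1) * p k) (wR (m + 1) a l u') x y v w) atTop (𝓝 (wR (m + 1) a l u' x y v w)) :=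
    fun x y v w => (tendsto_arr (hR l u') (by linarith) x y v w).comp hσ
  have T4 := tendsto_eYe (σ := fun k => (m + 1) * p k) (κ := κ) (u := u) (l := l) (u' := u') (decays_Rgt_dB m ha) (by linarith)
    (fun k => isPeriodic₂_Rgt (m + 1) a ha ⟨p k, rfl⟩ () ()) hσ x z α β
  simp only [K5, K5Inf, Pi.add_apply, Pi.sub_apply, Pi.neg_apply, eYeInf]
  exact ((((tendsto_dSw_apply T1 x z α β).neg).add (tendsto_jetC_apply l u' T2 x z α β)).sub (tendsto_jetR_apply κ u T3 x z α β)).add T4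

/-- [folklore] **(u2) FOR `K7`**. -/
theorem tendsto_K7 (ha : 0 < a) (hp : Tendsto p atTop atTop) (x z : Fin 4 → ℤ) (α β : Fin 4) :
    Tendsto (fun k => K7 ((m + 1) * p k) (m + 1) a κ u l u' x z α β) atTop (𝓝 (K7Inf (m + 1) a κ u l u' x z α β)) := by
  have hσ := tendsto_sigma m p hp
  have hd := dB_pos (m + 1) a ha
  obtain ⟨C, hC⟩ := decays_Cgh_dB m ha
  obtain ⟨CG, -, hG⟩ := TorusWeightWordArrays.biLoc_lapU_Cgh_Lgh m ha
  obtain ⟨CW, -, hW⟩ := biLoc_wC m ha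
  have hX : BiLoc (comp (comp (comp lapU (Cgh (m + 1) a)) (Lgh κ u)) (Cgh (m + 1) a)) u u _ (dB (m + 1) a / 8) :=
    biLoc_comp_right (hG κ u) (decays_of_le hC (by linarith)) (by linarith) (by linarith)
  have T1 : ∀ x y v w, Tendsto (fun k => comp (comp (comp (comp lapU (Cgh (m + 1) a)) (Lgh κ u)) (Cgh (m + 1) a)) (arr ((m + 1) * p k) (ghCur l u')) x y v w)
      atTop (𝓝 (comp (comp (comp (comp lapU (Cgh (m + 1) a)) (Lgh κ u)) (Cgh (m + 1) a)) (ghCur l u') x y v w)) :=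
    fun x y v w => tendsto_comp_arr_apply (σ := fun k => (m + 1) * p k) hX (biLoc_ghCur l u' (dB (m + 1) a / 8)) (by linarith) hσ x y v w
  have T2 : ∀ x y v w, Tendsto (fun k => arr ((m + 1) * p k) (wC (m + 1) a κ u) x y v w) atTop (𝓝 (wC (m + 1) a κ u x y v w)) :=
    fun x y v w => (tendsto_arr (hW κ u) (by linarith) x y v w).comp hσ
  simp only [K7, K7Inf, Pi.add_apply, Pi.neg_apply]
  exact ((tendsto_dSw_apply T1 x z α β).neg).add (tendsto_jetC_apply l u' T2 x z α β)

/-- [folklore] **(u2) FOR `K9`**. -/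
theorem tendsto_K9 (ha : 0 < a) (hp : Tendsto p atTop atTop) (x z : Fin 4 → ℤ) (α β : Fin 4) :
    Tendsto (fun k => K9 ((m + 1) * p k) (m + 1) a κ u l u' x z α β) atTop (𝓝 (K9Inf (m + 1) a κ u l u' x z α β)) := by
  have hσ := tendsto_sigma m p hp
  have hd := dB_pos (m + 1) a ha
  obtain ⟨CR, -, hR⟩ := biLoc_wR m ha
  have T2 : ∀ x y v w, Tendsto (fun k => arr ((m + 1) * p k) (wR (m + 1) a κ u) x y v w) atTop (𝓝 (wR (m + 1) a κ u x y v w)) :=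
    fun x y v w => (tendsto_arr (hR κ u) (by linarith) x y v w).comp hσ
  have T3 : ∀ x y v w, Tendsto (fun k => arr ((m + 1) * p k) (wR (m + 1) a l u') x y v w) atTop (𝓝 (wR (m + 1) a l u' x y v w)) :=
    fun x y v w => (tendsto_arr (hR l u') (by linarith) x y v w).comp hσ
  have T1 := tendsto_ite_torus (u := u) (u' := u') hσ κ l (tendsto_const_nhds (x := dSw (comp (comp lapU (Cgh (m + 1) a)) (gh₂ κ u)) x z α β))
  have T4 := tendsto_ite_torus (u := u) (u' := u') hσ κ l (tendsto_const_nhds (x := jetC κ u (Rgt (m + 1) a) x z α β))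
  simp only [K9, K9Inf, Pi.add_apply, Pi.sub_apply, ite_apply, Pi.zero_apply]
  exact ((T1.sub (tendsto_jetC_apply l u' T2 x z α β)).sub (tendsto_jetC_apply κ u T3 x z α β)).add T4

/-- [folklore] **(u2) FOR `Z4`** (site entries). -/
theorem tendsto_Z4 (ha : 0 < a) (hp : Tendsto p atTop atTop) (x z : Fin 4 → ℤ) (v w : Unit) :
    Tendsto (fun k => Z4 ((m + 1) * p k) (m + 1) a κ u l u' x z v w) atTop (𝓝 (Z4Inf (m + 1) a κ u l u' x z v w)) := by
  have hσ := tendsto_sigma m p hp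
  have hd := dB_pos (m + 1) a ha
  obtain ⟨C₂, hC₂⟩ := decays_Cgh_lapU (m + 1) a ha
  obtain ⟨C, hC⟩ := decays_Cgh_dB m ha
  obtain ⟨CR, -, hR⟩ := biLoc_wR m ha
  obtain ⟨CG, -, hG⟩ := TorusWeightWordArrays.biLoc_lapU_Cgh_Lgh m ha
  -- M2-type families: `(wR_β ∘ arr ghCur_β′) ∘ A₂`
  have U2 : ∀ (κ l : Fin 4) (u u' : Fin 4 → ℤ) (k : ℕ), BiLoc (comp (wR (m + 1) a κ u) (arr ((m + 1) * p k) (ghCur l u'))) u u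
      ((Fintype.card Unit : ℝ) * (CR * (Real.exp (dB (m + 1) a / 4) * Zl 4 (dB (m + 1) a / 4 / 2) * 1)) * Zl 4 (dB (m + 1) a / 4 / 2 - dB (m + 1) a / 4 / 4))
      (dB (m + 1) a / 4 / 4) := by
    intro κ l u u' k
    have h := biLoc_comp_arr ((m + 1) * p k) (hR κ u) (biLoc_ghCur l u' (dB (m + 1) a / 4)) (by linarith)
    rw [sub_self, l1_zero, mul_zero, Real.exp_zero] at h
    exact h
  have L2 : ∀ (κ l : Fin 4) (u u' : Fin 4 → ℤ) (x y : Fin 4 → ℤ) (v' w' : Unit),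
      Tendsto (fun k => comp (comp (wR (m + 1) a κ u) (arr ((m + 1) * p k) (ghCur l u'))) (comp (Cgh (m + 1) a) lapU) x y v w) atTop
        (𝓝 (comp (comp (wR (m + 1) a κ u) (ghCur l u')) (comp (Cgh (m + 1) a) lapU) x y v w)) :=
    fun κ l u u' x y v' w' => tendsto_comp_right_of_uniform hC₂ (by linarith) (U2 κ l u u') (by linarith)
      (fun x y v w => tendsto_comp_arr_apply (σ := fun k => (m + 1) * p k) (hR κ u) (biLoc_ghCur l u' (dB (m + 1) a / 4)) (by linarith) hσ x y v w)
      x y v' w'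
  -- M5-type families: `(((A₁∘Lgh_β)∘Cgh) ∘ arr Lgh_β′) ∘ A₂`
  have hX : ∀ (κ : Fin 4) (u : Fin 4 → ℤ), BiLoc (comp (comp (comp lapU (Cgh (m + 1) a)) (Lgh κ u)) (Cgh (m + 1) a)) u u
      ((Fintype.card Unit : ℝ) * (CG * |C|) * Zl 4 (dB (m + 1) a / 4 - dB (m + 1) a / 8)) (dB (m + 1) a / 8) :=
    fun κ u => biLoc_comp_right (hG κ u) (decays_of_le hC (by linarith)) (by linarith) (by linarith)
  have U5 : ∀ (κ l : Fin 4) (u u' : Fin 4 → ℤ) (k : ℕ),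
      BiLoc (comp (comp (comp (comp lapU (Cgh (m + 1) a)) (Lgh κ u)) (Cgh (m + 1) a)) (arr ((m + 1) * p k) (Lgh l u'))) u u
        ((Fintype.card Unit : ℝ) * (((Fintype.card Unit : ℝ) * (CG * |C|) * Zl 4 (dB (m + 1) a / 4 - dB (m + 1) a / 8))
          * (cL * Zl 4 (dB (m + 1) a / 8 / 2))) * Zl 4 (dB (m + 1) a / 8 / 2 - dB (m + 1) a / 8 / 4))
        (dB (m + 1) a / 8 / 4) := by
    intro κ l u u' k
    have h := biLoc_comp_arr ((m + 1) * p k) (hX κ u) (StepJetData.biLoc_weaken (biLoc_Lgh l u') le_rfl (by linarith [dB_le_one (m + 1) a])) (by linarith)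
    rw [sub_self, l1_zero, mul_zero, Real.exp_zero, mul_one] at h
    exact h
  have L5 : ∀ (κ l : Fin 4) (u u' : Fin 4 → ℤ) (x y : Fin 4 → ℤ) (v' w' : Unit),
      Tendsto (fun k => comp (comp (comp (comp (comp lapU (Cgh (m + 1) a)) (Lgh κ u)) (Cgh (m + 1) a)) (arr ((m + 1) * p k) (Lgh l u'))) (comp (Cgh (m + 1) a) lapU)
        x y v w) atTop
        (𝓝 (comp (comp (comp (comp (comp lapU (Cgh (m + 1) a)) (Lgh κ u)) (Cgh (m + 1) a)) (Lgh l u')) (comp (Cgh (m + 1) a) lapU) x y v w)) :=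
    fun κ l u u' x y v' w' => tendsto_comp_right_of_uniform hC₂ (by linarith) (U5 κ l u u') (by linarith)
      (fun x y v w => tendsto_comp_arr_apply (σ := fun k => (m + 1) * p k) (hX κ u)
        (StepJetData.biLoc_weaken (biLoc_Lgh l u') le_rfl (by linarith [dB_le_one (m + 1) a])) (by linarith) hσ x y v w) x y v' w'
  have T1 := tendsto_ite_torus (u := u) (u' := u') hσ κ l (tendsto_const_nhds (x :=
    (comp (comp (comp lapU (Cgh (m + 1) a)) (gh₂ κ u)) (comp lapU (comp (Cgh (m + 1) a) lapU))
      + comp (comp (comp (comp lapU (Cgh (m + 1) a)) lapU) (gh₂ κ u)) (comp (Cgh (m + 1) a) lapU)) x z v w))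
  simp only [Z4, Z4Inf, Pi.add_apply, Pi.neg_apply, ite_apply, Pi.zero_apply]
  exact ((((T1.add (L2 κ l u u' x z v w)).add (L2 l κ u' u x z v w)).neg).add (L5 κ l u u' x z v w)).add (L5 l κ u' u x z v w)

/-- [folklore] **(u2) FOR `K4 = dSw Z4`**. -/
theorem tendsto_K4 (ha : 0 < a) (hp : Tendsto p atTop atTop) (x z : Fin 4 → ℤ) (α β : Fin 4) :
    Tendsto (fun k => K4 ((m + 1) * p k) (m + 1) a κ u l u' x z α β) atTop (𝓝 (K4Inf (m + 1) a κ u l u' x z α β)) := by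
  simp only [K4, K4Inf]
  exact tendsto_dSw_apply (fun x y v w => tendsto_Z4 m p κ u l u' ha hp x y v w) x z α β

end Pieces

/-! ## §4 The limit of the mixed table -/

section Total

variable (m : ℕ) {a : ℝ} (p : ℕ → ℕ) [∀ k, NeZero (p k)] (κ : Fin 4) (u : Fin 4 → ℤ) (l : Fin 4) (u' : Fin 4 → ℤ)

/-- [folklore] **(u2) FOR `BwMix`**: along any family of tori `(m+1)·p k → ∞`, every entry of the k-th mixed table converges to the
corresponding entry of `BwMixInf (m+1) a κ u l u′` — the letter `hlim` of `SortedArrayLimitUniform.tendsto_hessT_sortK_hessKer_of_uniform`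
for the `ℬ₂` part of `𝒲N k`. -/
theorem tendsto_BwMix (ha : 0 < a) (hp : Tendsto p atTop atTop) (x z : Fin 4 → ℤ) (α β : Fin 4) :
    Tendsto (fun k => BwMix ((m + 1) * p k) (m + 1) a κ u l u' x z α β) atTop (𝓝 (BwMixInf (m + 1) a κ u l u' x z α β)) := by
  have T4 := tendsto_K4 m p κ u l u' ha hp
  have T5 := tendsto_K5 m p κ u l u' ha hp
  have T7 := tendsto_K7 m p κ u l u' ha hp
  have T8 := tendsto_K7 m p l u' κ u ha hp
  have T9 := tendsto_K9 m p κ u l u' ha hp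
  simp only [BwMix, BwMixInf, Pi.smul_apply, Pi.add_apply, Pi.sub_apply, smul_eq_mul, trK]
  exact (((((((((T9 z x β α).sub (T8 z x β α)).sub (T7 z x β α)).add (T4 x z α β)).add (T5 x z α β)).add (T5 z x β α)).add
    (T7 x z α β)).add (T8 x z α β)).add (T9 x z α β)).const_mul 2

end Total

end Summit.QuantumFields.BalabanUV.Beta.D1BFx.TorusWeightMixedLimit

end
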